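import Literature.MathematicalPhysics.QuantumFieldTheory.Balaban1983to89.B9RWSums346MixedFactorFromLegs

/-!
# `Balaban1983to89.B9RWSums344InputFactorFromLegs` — T. Bałaban, *Propagators for lattice gauge theories in a background field*, Commun. Math. Phys. **99**
# (1985) 389–434 [Balaban1985BackgroundPropagators] (3.44) p. 398 with (3.88)–(3.89) p. 409 and [4] (2.39)–(2.44) pp. 229–230, (2.52)–(2.55) p. 232: THE THIRD-ORDER
# INPUT FACTOR `K(h_□)G′_□h_□∇*_{U,μ}` OF ROWS 18 FROM THE HÖLDER SOURCE CLASS INTO THE SUP BLOCKS — the schema `B9Thm37KLetterDir.FactorsInputPair37Dir` DERIVED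
# (not posited) from the letters' SUP majorants (`Identities₂`, no transposes) and two letter-free INPUT legs of the local propagator `G′_□` (the Hölder-input twin of
# `B9RWSums346MixedFactorFromLegs`)

statement-level skeleton of published theorems with citation tags; proofs where landed; nothing here is a claim about the Yang–Mills mass gap

THE PRINT.  (3.44) p. 398: *«|(G′(U)∇\*_Uλ)(x)|, |(∇_UG′(U)∇\*_Uλ)(x)|, |(Δ_UG′(U)∇\*_Uλ)(x)| ≦ B₀[Lʲη, 1, (Lʲη)^{−1}]·(…)·e^{−δ₀d(y,y′)}‖λ‖_{ε}»* (Hölder source norms);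
(3.88)–(3.89) p. 409: *«Δ′_aG′₀ = I − Σ_□K(h_□)G′_□h_□ = I − R′ … K(h_□)G_□h_□ satisfies the inequality (3.89)»*, `K(h_□) = Σ_μ P_{□,μ}∇_{U,μ} + C_□`
([4] (2.39)–(2.40)); the coefficient sizes `|∂h_□| ≦ O(1)(MLʲη)⁻¹`, `|Δh_□| ≦ O(1)(MLʲη)⁻²` ([4] (2.41)–(2.44)).

WHY THIS FILE (cell `pub-ymgap`, Track A node N06 [B9], rows 18; width seat `pub-ymgap-dag-n06-w7`, g1, 2026-08-28).  The N06 certificate (dag-n06-d, editions 32–39) DISPLAYS in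
its rows-18 binder `h36H` the schema `FactorsInputPair37Dir (𝔬 x) (𝔡 x) (𝔩 x) 1 (H x) (bHX x) p.θI p.δ₀ U` (`HasMaj (bHX ε) (ofBlocks blk) ((K(h_□)·G′_□·M_{h_□}) ∘ ∇\*_μ)
(1_{S′_□}(y)·θ_I(ε)·(L^{j_y}η)⁻¹·e^{−δ₀d})` — the terms `K(h_□)G′_□h_□∇\*_{U,μ}` of `R′∇\*_μ` read from the Hölder source class `bHX ε` into the sharp blocks, hypothesis `hFL` of the
input-pair resummation).  Like its `L²` sibling it is NOT letter-free (`K(h_□) = KopDir 𝔬 𝔡 𝔩` over the abstract direction letters), but here the TARGET is the sup block norm, so the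
letters' displayed SUP majorants (`Identities₂.hP ∕ hC`, kernels `KPd`, `KC` with `StaticOK`'s weighted rows and ranges) compose DIRECTLY with the legs — no transposes, no Schur:
* §1 `HasMaj` bookkeeping (finite sums) and ★ `hasMaj_localLetter_comp`: a letter with a LOCAL sup majorant `K ≧ 0` (range `ρ`, weighted rows `Σ_z K(a,z)·(L^{j_z}η)^m ≦ 1_S(a)·k`) after a
  leg with majorant `C·(L^{j_z}η)^q·e^{−δ₁d(z,y′)}` from ANY source block norm `b₁` into the sharp blocks has the majorant `1_S(y)·(k·C·L₀^{|q−m|}·e^{(αδ+δ₁)ρ})·(L^{j_y}η)^{q−m}·e^{−δ₁d(y,y′)}`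
  (`B11SectG.hasMaj_comp`; inside the range the source scale moves to `y` by p. 398's transfer and the decay factor by the triangle inequality — no row sum).
* §2 ★★ `factorsInputPair37Dir_of_inputLegs`: `Identities₂` (`hP`, `KPd_nonneg`, `KPd_sum`, `hC`), `StaticOK` (`KP_row∕KP_loc`, `KC_row∕KC_loc∕KC_nonneg`), `Facts347`, `0 ≤ αδ`,
  `0 ≤ δ₁`, and the two UNCUT INPUT LEGS `hMixI : ∀ ε>0, ∀ i ν μ, HasMaj (bHX ε) (ofBlocks blk) (∇_ν ∘ ((G′_iM_{h_i}) ∘ ∇\*_μ)) (B_I(ε)·e^{−δ₁d})`,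
  `hOneI : ∀ ε>0, ∀ i μ, HasMaj (bHX ε) (ofBlocks blk) ((G′_iM_{h_i}) ∘ ∇\*_μ) (B₁(ε)·(L^{j_z}η)·e^{−δ₁d})` ⊢ `FactorsInputPair37Dir 𝔬 𝔡 𝔩 R H bHX θ_I δ₁ U`,
  `θ_I(ε) = (|Dir|·kP·B_I(ε) + kC·B₁(ε))·L₀·e^{(αδ+δ₁)ρ}`.
HONEST NOTE.  The uncut INPUT legs have no 𝔸-level producer in the tree today (print's Hölder-source estimates (3.44) for `G′_□` are not typed); the gain is that the abstract
K-letter leaves this displayed analytic binder, the legs being statements about the pinned objects `Gsq ∕ h ∕ Dd ∕ Dsd` only.  Majorant bookkeeping over landed modules; the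
majorants, kernel rows, `Facts347` and the legs are HYPOTHESES where used; nothing of [B9] asserted; COUNT-NEUTRAL; N06 NOT discharged; nothing continuum ∕ OS ∕ mass gap ∕ Clay.
NEW file; nothing landed is modified; net new unproved facts: 0; 0 `def`.
-/

namespace Literature.MathematicalPhysics.QuantumFieldTheory.Balaban1983to89.B9RWSums344InputFactorFromLegs

open Literature.MathematicalPhysics.QuantumFieldTheory.Balaban1983to89
open Finset B6RandomWalk B6RandomWalkHom B9Thm37Sum B9Thm34Ext B9Thm37Glue B9Thm37Whole
open B9RWSums343to347Whole B9RWSums346Schur B11SectG B9SectDL2Decay B9RWSums346SecondDiffGp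
open B9Thm37WholeDir B9Thm37KLetterDir B9Ineq347 B9RWSums346MixedFactorFromLegs

noncomputable section

/-! ## §1 `HasMaj` bookkeeping and the local-letter composition into the sharp blocks -/

section Bookkeeping

variable {g : B9.Geometry} [Fintype g.Site] [DecidableEq g.Site] {R : ℝ} {H : Prop} {X : Type} [Fintype X]
variable {F₁ : Type} [AddCommGroup F₁] [Module ℝ F₁]

omit [DecidableEq g.Site] [Fintype X] in
/-- majorants of a finite sum of operators: the kernels add. [cite: Balaban1984PropagatorsII, (2.52)–(2.55) p.232, bookkeeping] -/
theorem hasMaj_finsetSum {κ' : Type} (s : Finset κ') {b₁ : BlockNorm (toB6 g R H) F₁} {b₂ : BlockNorm (toB6 g R H) (X → ℝ)}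
    (T : κ' → F₁ →ₗ[ℝ] (X → ℝ)) (K : κ' → g.Site → g.Site → ℝ) (h : ∀ k ∈ s, HasMaj b₁ b₂ (T k) (K k)) :
    HasMaj b₁ b₂ (∑ k ∈ s, T k) (fun a b => ∑ k ∈ s, K k a b) := by
  classical
  induction s using Finset.induction_on with
  | empty => simpa only [Finset.sum_empty] using hasMaj_zero b₁ b₂
  | insert k s hk ih =>
      have hk' := h k (Finset.mem_insert_self k s)
      have hs' := ih fun j hj => h j (Finset.mem_insert_of_mem hj)
      rw [Finset.sum_insert hk]
      exact (hk'.add hs').mono fun a b => by rw [Finset.sum_insert hk]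

/-- ★ **A LOCAL SUP-MAJORISED LETTER AFTER A LEG INTO THE SHARP BLOCKS**: `T` with a sup majorant `K ≧ 0` of range `ρ` and weighted rows `Σ_z K(a,z)·(L^{j_z}η)^m ≦ 1_S(a)·k`,
after `P` with the majorant `C·(L^{j_z}η)^q·e^{−δ₁d(z,y′)}` from any source block norm `b₁` into the sharp blocks of `blk`, has the majorant
`1_S(y)·(k·C·L₀^{|q−m|}·e^{(αδ+δ₁)ρ})·(L^{j_y}η)^{q−m}·e^{−δ₁d(y,y′)}` (`|q − m| ≦ 4`, `0 ≦ αδ`, `0 ≦ δ₁`): [4] (2.52)–(2.55) with the scale moved to `y` inside the range (p. 398) and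
`d(z,y′) ≧ d(y,y′) − ρ`. [cite: Balaban1985BackgroundPropagators, (3.44) p.398 + remark after (3.47) p.398 + (3.89) p.409; Balaban1984PropagatorsII, (2.41)–(2.44) p.230 + (2.52)–(2.55) p.232] -/
theorem hasMaj_localLetter_comp (blk : X → g.Site) {b₁ : BlockNorm (toB6 g R H) F₁} {T : Module.End ℝ (X → ℝ)} {P : F₁ →ₗ[ℝ] (X → ℝ)}
    {K : g.Site → g.Site → ℝ} (S : Finset g.Site) {d : ℕ} {δ α L₀ k C ρ q m δ₁ : ℝ} (hF : Facts347 g R H d δ α L₀)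
    (htri : ∀ a b c : g.Site, g.dist a c ≤ g.dist a b + g.dist b c) (hlen : ∀ y : g.Site, 0 < g.len y)
    (hC : 0 ≤ C) (hαδ : 0 ≤ α * δ) (hδ₁ : 0 ≤ δ₁) (hqm : |q - m| ≤ 4)
    (hK0 : ∀ a b, 0 ≤ K a b) (hKloc : ∀ a b, K a b ≠ 0 → g.dist a b ≤ ρ) (hKrow : ∀ a, ∑ z : g.Site, K a z * g.len z ^ m ≤ if a ∈ S then k else 0)
    (hT : HasMajorant (g := toB6 g R H) blk T K)
    (hP : HasMaj b₁ (BlockNorm.ofBlocks (toB6 g R H) blk) P (fun (z y' : g.Site) => C * g.len z ^ q * Real.exp (-(δ₁ * g.dist z y')))) :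
    HasMaj b₁ (BlockNorm.ofBlocks (toB6 g R H) blk) (T ∘ₗ P)
      (fun (y y' : g.Site) => (if y ∈ S then (1 : ℝ) else 0) * (k * C * L₀ ^ |q - m| * Real.exp ((α * δ + δ₁) * ρ)) * g.len y ^ (q - m) *
        Real.exp (-(δ₁ * g.dist y y'))) := by
  have hlen0 : ∀ y : g.Site, 0 ≤ g.len y := fun y => (hlen y).le
  have hL0 : 0 ≤ g.L := zero_le_one.trans hF.one_le_L
  have hL₀ : 0 ≤ L₀ := hL0.trans hF.L_le
  have hT' : HasMaj (BlockNorm.ofBlocks (toB6 g R H) blk) (BlockNorm.ofBlocks (toB6 g R H) blk) T K := hasMaj_of_hasMajorant (g := toB6 g R H) blk hK0 hT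
  have hcomp := hasMaj_comp hT' hP hK0
  refine hcomp.mono fun y y' => ?_
  rw [show (BlockNorm.ofBlocks (toB6 g R H) blk).κ = (1 : ℝ) from rfl]
  simp only [one_mul]
  -- termwise: inside the range, move the scale `(L^{j_z}η)^{q−m}` to `y` and the decay factor to `d(y,y′)`
  have hterm : ∀ z : g.Site, K y z * (C * g.len z ^ q * Real.exp (-(δ₁ * g.dist z y')))
      ≤ (K y z * g.len z ^ m) * (C * L₀ ^ |q - m| * Real.exp ((α * δ + δ₁) * ρ) * g.len y ^ (q - m) * Real.exp (-(δ₁ * g.dist y y'))) := by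
    intro z
    by_cases hKz : K y z = 0
    · rw [hKz, zero_mul, zero_mul, zero_mul]
    have hd : g.dist y z ≤ ρ := hKloc y z hKz
    -- the scale transfer at distance ≤ ρ
    have hst : Real.exp (-(α * δ * g.dist y z)) * g.len z ^ (q - m) ≤ g.L ^ |q - m| * g.len y ^ (q - m) := scaleTransfer_len_rpow hF (q - m) hqm y z
    have htr : g.len z ^ (q - m) ≤ L₀ ^ |q - m| * Real.exp (α * δ * ρ) * g.len y ^ (q - m) := by
      have h1 : g.len z ^ (q - m) ≤ Real.exp (α * δ * g.dist y z) * (g.L ^ |q - m| * g.len y ^ (q - m)) := by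
        have h := mul_le_mul_of_nonneg_left hst (Real.exp_nonneg (α * δ * g.dist y z))
        rwa [← mul_assoc, ← Real.exp_add, show α * δ * g.dist y z + -(α * δ * g.dist y z) = 0 by ring, Real.exp_zero, one_mul] at h
      have h2 : Real.exp (α * δ * g.dist y z) ≤ Real.exp (α * δ * ρ) := Real.exp_le_exp.mpr (mul_le_mul_of_nonneg_left hd hαδ)
      have h3 : g.L ^ |q - m| ≤ L₀ ^ |q - m| := Real.rpow_le_rpow hL0 hF.L_le (abs_nonneg _)
      calc g.len z ^ (q - m) ≤ Real.exp (α * δ * g.dist y z) * (g.L ^ |q - m| * g.len y ^ (q - m)) := h1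
        _ ≤ Real.exp (α * δ * ρ) * (L₀ ^ |q - m| * g.len y ^ (q - m)) :=
            mul_le_mul h2 (mul_le_mul_of_nonneg_right h3 (Real.rpow_nonneg (hlen0 y) _)) (mul_nonneg (Real.rpow_nonneg hL0 _) (Real.rpow_nonneg (hlen0 y) _))
              (Real.exp_nonneg _)
        _ = L₀ ^ |q - m| * Real.exp (α * δ * ρ) * g.len y ^ (q - m) := by ring
    -- the decay factor: d(y,y′) ≤ d(y,z) + d(z,y′) ≤ ρ + d(z,y′)
    have hdec : Real.exp (-(δ₁ * g.dist z y')) ≤ Real.exp (δ₁ * ρ) * Real.exp (-(δ₁ * g.dist y y')) := by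
      rw [← Real.exp_add]
      exact Real.exp_le_exp.mpr (by nlinarith [htri y z y', hd, hδ₁])
    -- the scale split `len z ^ q = len z ^ m * len z ^ (q - m)`
    have hsplit : g.len z ^ q = g.len z ^ m * g.len z ^ (q - m) := by
      rw [← Real.rpow_add (hlen z)]; congr 1; ring
    have hKm : 0 ≤ K y z * g.len z ^ m := mul_nonneg (hK0 y z) (Real.rpow_nonneg (hlen0 z) _)
    have hprod := mul_le_mul htr hdec (Real.exp_nonneg _) (mul_nonneg (mul_nonneg (Real.rpow_nonneg hL₀ _) (Real.exp_nonneg _)) (Real.rpow_nonneg (hlen0 y) _))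
    calc K y z * (C * g.len z ^ q * Real.exp (-(δ₁ * g.dist z y')))
        = (K y z * g.len z ^ m) * C * (g.len z ^ (q - m) * Real.exp (-(δ₁ * g.dist z y'))) := by rw [hsplit]; ring
      _ ≤ (K y z * g.len z ^ m) * C * ((L₀ ^ |q - m| * Real.exp (α * δ * ρ) * g.len y ^ (q - m)) * (Real.exp (δ₁ * ρ) * Real.exp (-(δ₁ * g.dist y y')))) :=
          mul_le_mul_of_nonneg_left hprod (mul_nonneg hKm hC)
      _ = (K y z * g.len z ^ m) * (C * L₀ ^ |q - m| * (Real.exp (α * δ * ρ) * Real.exp (δ₁ * ρ)) * g.len y ^ (q - m) * Real.exp (-(δ₁ * g.dist y y'))) := by ring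
      _ = (K y z * g.len z ^ m) * (C * L₀ ^ |q - m| * Real.exp ((α * δ + δ₁) * ρ) * g.len y ^ (q - m) * Real.exp (-(δ₁ * g.dist y y'))) := by
          rw [← Real.exp_add]; congr 2; ring
  have hrow := hKrow y
  have hfac0 : 0 ≤ C * L₀ ^ |q - m| * Real.exp ((α * δ + δ₁) * ρ) * g.len y ^ (q - m) * Real.exp (-(δ₁ * g.dist y y')) :=
    mul_nonneg (mul_nonneg (mul_nonneg (mul_nonneg hC (Real.rpow_nonneg hL₀ _)) (Real.exp_nonneg _)) (Real.rpow_nonneg (hlen0 y) _)) (Real.exp_nonneg _)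
  calc ∑ z : g.Site, K y z * (C * g.len z ^ q * Real.exp (-(δ₁ * g.dist z y')))
      ≤ ∑ z : g.Site, (K y z * g.len z ^ m) * (C * L₀ ^ |q - m| * Real.exp ((α * δ + δ₁) * ρ) * g.len y ^ (q - m) * Real.exp (-(δ₁ * g.dist y y'))) :=
        Finset.sum_le_sum fun z _ => hterm z
    _ = (∑ z : g.Site, K y z * g.len z ^ m) * (C * L₀ ^ |q - m| * Real.exp ((α * δ + δ₁) * ρ) * g.len y ^ (q - m) * Real.exp (-(δ₁ * g.dist y y'))) := by
        rw [Finset.sum_mul]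
    _ ≤ (if y ∈ S then k else 0) * (C * L₀ ^ |q - m| * Real.exp ((α * δ + δ₁) * ρ) * g.len y ^ (q - m) * Real.exp (-(δ₁ * g.dist y y'))) :=
        mul_le_mul_of_nonneg_right hrow hfac0
    _ = (if y ∈ S then (1 : ℝ) else 0) * (k * C * L₀ ^ |q - m| * Real.exp ((α * δ + δ₁) * ρ)) * g.len y ^ (q - m) * Real.exp (-(δ₁ * g.dist y y')) := by
        split_ifs <;> ring

end Bookkeeping

/-! ## §2 The input factor `K(h_□)G′_□h_□∇*_{U,μ}` from the letters' sup majorants and the uncut input legs -/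

section InputFactor

variable {g : B9.Geometry} [Fintype g.Site] [DecidableEq g.Site] {R : ℝ} {H : Prop} {B : B9.Backgrounds}
variable {X Y ι Dir : Type} [Fintype ι] [Fintype Dir]

/-- ★★ **ROWS 18's THIRD-ORDER INPUT FACTOR SCHEMA DERIVED**: the letters' displayed sup majorants (`Identities₂.hP` with `KPd_sum`, `Identities₂.hC`), the kernel rows and ranges of
`StaticOK` (`Σ_z KP(a,z)·L^{j_z}η ≦ 1_{S′}(a)·kP`, `Σ_z KC(a,z)·(L^{j_z}η)² ≦ 1_{S′}(a)·kC`, ranges `≦ ρ`), `Facts347` (scale transfer) and the two UNCUT INPUT LEGS of the cube operator from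
the Hölder source class — `hMixI` (`∇_νG′_iM_{h_i}∇\*_μ`, majorant `B_I(ε)·e^{−δ₁d}`) and `hOneI` (`G′_iM_{h_i}∇\*_μ`, majorant `B₁(ε)·(L^{j_z}η)·e^{−δ₁d}`) — give
`FactorsInputPair37Dir 𝔬 𝔡 𝔩 R H bHX θ_I δ₁ U` with `θ_I(ε) = (|Dir|·kP·B_I(ε) + kC·B₁(ε))·L₀·e^{(αδ+δ₁)ρ}`.  No transposes: the target norm is the sup block norm.
[cite: Balaban1985BackgroundPropagators, (3.88)–(3.89) p.409 + (3.44) p.398 + remark after (3.47) p.398; Balaban1984PropagatorsII, (2.39)–(2.44) pp.229–230 + (2.52)–(2.55) p.232] -/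
theorem factorsInputPair37Dir_of_inputLegs [Fintype X] (𝔬 : Ops g B X Y ι) (𝔡 : DirOps37 𝔬 Dir) (𝔩 : DirLetters37 𝔬 Dir) (R : ℝ) (H : Prop)
    (bHX : ℝ → BlockNorm (toB6 g R H) (X → ℝ)) (d : ℕ) (δ α L₀ ρ N N' Cℓ δ₁ : ℝ) (BI B1 : ℝ → ℝ) (κ : Sizes) (U : B.Cfg)
    (hBI : ∀ ε, 0 < ε → 0 ≤ BI ε) (hB1 : ∀ ε, 0 < ε → 0 ≤ B1 ε) (hαδ : 0 ≤ α * δ) (hδ₁ : 0 ≤ δ₁)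
    (hs : StaticOK 𝔬 ρ N N' Cℓ κ) (hF : Facts347 g R H d δ α L₀) (hi : Identities₂ 𝔬 𝔡 𝔩 R H U)
    (hMixI : ∀ ε : ℝ, 0 < ε → ∀ (i : ι) (ν μ : Dir), HasMaj (bHX ε) (BlockNorm.ofBlocks (toB6 g R H) 𝔬.blk)
      (𝔡.Dd U ν ∘ₗ ((𝔬.Gsq U i * mulOp (𝔬.h i)) ∘ₗ 𝔡.Dsd U μ)) (fun (y y' : g.Site) => BI ε * Real.exp (-(δ₁ * g.dist y y'))))
    (hOneI : ∀ ε : ℝ, 0 < ε → ∀ (i : ι) (μ : Dir), HasMaj (bHX ε) (BlockNorm.ofBlocks (toB6 g R H) 𝔬.blk)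
      ((𝔬.Gsq U i * mulOp (𝔬.h i)) ∘ₗ 𝔡.Dsd U μ) (fun (y y' : g.Site) => B1 ε * g.len y ^ (1 : ℝ) * Real.exp (-(δ₁ * g.dist y y')))) :
    FactorsInputPair37Dir 𝔬 𝔡 𝔩 R H bHX (fun ε => ((Fintype.card Dir : ℝ) * (κ.kP * BI ε) + κ.kC * B1 ε) * L₀ * Real.exp ((α * δ + δ₁) * ρ)) δ₁ U := by
  classical
  have hlen0 : ∀ y : g.Site, 0 ≤ g.len y := fun y => (hs.lenpos y).le
  refine ⟨fun ε hε i μ => ?_⟩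
  -- the P-terms: per direction, the letter `P_{i,ν}` (kernel `KPd i ν ≤ KP i`, weighted rows with `m = 1`) after the uncut mixed input leg (`q = 0`)
  have hProw : ∀ (ν : Dir) (a : g.Site), ∑ z : g.Site, 𝔩.KPd i ν a z * g.len z ^ (1 : ℝ) ≤ if a ∈ 𝔬.S' i then κ.kP else 0 := by
    intro ν a
    have hle : ∀ z, 𝔩.KPd i ν a z ≤ 𝔬.KP i a z := fun z =>
      (Finset.single_le_sum (f := fun μ' => 𝔩.KPd i μ' a z) (fun μ' _ => hi.KPd_nonneg i μ' a z) (Finset.mem_univ ν)).trans (hi.KPd_sum i a z)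
    calc ∑ z : g.Site, 𝔩.KPd i ν a z * g.len z ^ (1 : ℝ) ≤ ∑ z : g.Site, 𝔬.KP i a z * g.len z := Finset.sum_le_sum fun z _ => by
            rw [Real.rpow_one]; exact mul_le_mul_of_nonneg_right (hle z) (hlen0 z)
      _ ≤ _ := hs.KP_row i a
  have hPloc : ∀ (ν : Dir) (a b : g.Site), 𝔩.KPd i ν a b ≠ 0 → g.dist a b ≤ ρ := by
    intro ν a b hab
    refine hs.KP_loc i a b fun h0 => hab (le_antisymm ?_ (hi.KPd_nonneg i ν a b))
    exact (Finset.single_le_sum (f := fun μ' => 𝔩.KPd i μ' a b) (fun μ' _ => hi.KPd_nonneg i μ' a b) (Finset.mem_univ ν)).trans ((hi.KPd_sum i a b).trans h0.le)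
  have hPterm : ∀ ν : Dir, HasMaj (bHX ε) (BlockNorm.ofBlocks (toB6 g R H) 𝔬.blk) (𝔩.P U i ν ∘ₗ (𝔡.Dd U ν ∘ₗ ((𝔬.Gsq U i * mulOp (𝔬.h i)) ∘ₗ 𝔡.Dsd U μ)))
      (fun (y y' : g.Site) => (if y ∈ 𝔬.S' i then (1 : ℝ) else 0) * (κ.kP * BI ε * L₀ ^ |(0 : ℝ) - 1| * Real.exp ((α * δ + δ₁) * ρ)) * g.len y ^ ((0 : ℝ) - 1) *
        Real.exp (-(δ₁ * g.dist y y'))) := by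
    intro ν
    have hleg : HasMaj (bHX ε) (BlockNorm.ofBlocks (toB6 g R H) 𝔬.blk) (𝔡.Dd U ν ∘ₗ ((𝔬.Gsq U i * mulOp (𝔬.h i)) ∘ₗ 𝔡.Dsd U μ))
        (fun (z y' : g.Site) => BI ε * g.len z ^ (0 : ℝ) * Real.exp (-(δ₁ * g.dist z y'))) :=
      (hMixI ε hε i ν μ).mono fun z y' => by rw [Real.rpow_zero, mul_one]
    exact hasMaj_localLetter_comp (R := R) (H := H) 𝔬.blk (𝔬.S' i) (m := (1 : ℝ)) hF hs.tri hs.lenpos (hBI ε hε) hαδ hδ₁ (by norm_num)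
      (fun a b => hi.KPd_nonneg i ν a b) (hPloc ν) (hProw ν) (hi.hP i ν) hleg
  -- the C-term: the letter `C_i` (kernel `KC i`, weighted rows with `m = 2`) after the first-order input leg (`q = 1`)
  have hCrow : ∀ a : g.Site, ∑ z : g.Site, 𝔬.KC i a z * g.len z ^ (2 : ℝ) ≤ if a ∈ 𝔬.S' i then κ.kC else 0 := by
    intro a
    calc ∑ z : g.Site, 𝔬.KC i a z * g.len z ^ (2 : ℝ) = ∑ z : g.Site, 𝔬.KC i a z * g.len z ^ 2 := Finset.sum_congr rfl fun z _ => by rw [Real.rpow_two]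
      _ ≤ _ := hs.KC_row i a
  have hCterm : HasMaj (bHX ε) (BlockNorm.ofBlocks (toB6 g R H) 𝔬.blk) (𝔬.Cop U i ∘ₗ ((𝔬.Gsq U i * mulOp (𝔬.h i)) ∘ₗ 𝔡.Dsd U μ))
      (fun (y y' : g.Site) => (if y ∈ 𝔬.S' i then (1 : ℝ) else 0) * (κ.kC * B1 ε * L₀ ^ |(1 : ℝ) - 2| * Real.exp ((α * δ + δ₁) * ρ)) * g.len y ^ ((1 : ℝ) - 2) *
        Real.exp (-(δ₁ * g.dist y y'))) :=
    hasMaj_localLetter_comp (R := R) (H := H) 𝔬.blk (𝔬.S' i) (m := (2 : ℝ)) hF hs.tri hs.lenpos (hB1 ε hε) hαδ hδ₁ (by norm_num)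
      (fun a b => hs.KC_nonneg i a b) (fun a b hab => hs.KC_loc i a b hab) hCrow (hi.hC i) (hOneI ε hε i μ)
  have hPsum := hasMaj_finsetSum (R := R) (H := H) (Finset.univ : Finset Dir)
    (fun ν => 𝔩.P U i ν ∘ₗ (𝔡.Dd U ν ∘ₗ ((𝔬.Gsq U i * mulOp (𝔬.h i)) ∘ₗ 𝔡.Dsd U μ))) _ (fun ν _ => hPterm ν)
  have hall := hPsum.add hCterm
  rw [kopDir_Gsq_mulOp_comp_Dsd_eq]
  refine hall.mono fun y y' => le_of_eq ?_
  have hy : 0 < g.len y := hs.lenpos y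
  have hm1 : g.len y ^ ((0 : ℝ) - 1) = (g.len y)⁻¹ := by rw [zero_sub, Real.rpow_neg_one]
  have hm2 : g.len y ^ ((1 : ℝ) - 2) = (g.len y)⁻¹ := by norm_num; exact Real.rpow_neg_one (g.len y)
  have ha1 : |(0 : ℝ) - 1| = 1 := by norm_num
  have ha2 : |(1 : ℝ) - 2| = 1 := by norm_num
  simp only [Finset.sum_const, Finset.card_univ, nsmul_eq_mul, hm1, hm2, ha1, ha2, Real.rpow_one]
  ring

end InputFactor

end

end Literature.MathematicalPhysics.QuantumFieldTheory.Balaban1983to89.B9RWSums344InputFactorFromLegs
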